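import Literature.NumberTheory.GaloisRepresentations.GaloisCohomologyLayerInflationLimit
import Literature.NumberTheory.GaloisRepresentations.PresentationLayerTransport
import Literature.NumberTheory.GaloisRepresentations.HomDualReadoutLayerCocycle
import Literature.NumberTheory.GaloisRepresentations.IdeleProjection
import Literature.NumberTheory.GaloisRepresentations.IdeleLocalInvariantsPlaceSum
import HarnessLib

/-!
# The Ш²-cochain bridge, step S3a: DESCENT of a continuous `2`-cocycle of `Γ_K` with values in a limit module
# `lim→_E S_E` (`J̄ = lim→ J_E`, `C̄ = lim→ C_E`, `K̄ˣ = lim→ Eˣ`) to a `2`-cocycle of a finite layer `Gal(E/K)` in `S_E`, ON THE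
# NOSE on a representative, and the finite-place dictionary for `J̄`: the class of `(s, t) ↦ π_v Z(s, t)` in `H²(K_v, K̄_vˣ)` has
# Brauer invariant `inv_{w_v}[b]` (Serre CG I §2.2 Prop. 8; Tate, C–F VII §7.3 Cor. 7.4 (b), §8 Prop. 8.1, §11.2)

Route `SemiOrdinaryEisensteinDescent` (BSD, rung W-ALL row 2·3@3), Kolyvagin column, Cassels–Tate lane: print item
`CasselsTateLevelInputsFact` (stmt-BirchSwinnertonDyer-20191).  Its one remaining input for THE canonical invariant maps is `hPTc`
(Milne I Thm. 4.10 (a) for `Ш²(K, E[m])` in `PTChoice` cochain form, p628097); the bridge to it from cell bsd-schneider's obstruction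
map `Ψ` is the memo `Cruxes/WildKolyvaginUpperAtThree/SHA2-BRIDGE-w3g7.md` (w3 g7), steps S1 ✓ S2a ✓ S2b (w3 g7) · S3 · S4.  This file
is the FIRST HALF OF STEP S3 (memo §1 (vi), "descend `Z` to a layer cocycle `b`" and "`[π_v Z|_v] ↦ localInv E v [b]`"), written for
an ARBITRARY Galois layer system `D : GalLayerData K` of door-c5 (so that it serves `J̄ = (ideleData K)`, `C̄ = (classData K)` and
`K̄ˣ = (unitsData K)` alike) and for an ARBITRARY continuous `2`-cocycle (no presentation, no object of S2): it composes with w3 g7's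
`ShaTwoCochain.bridgeCocycle_mem` / `idele_class_of_bridgeCocycle` (p634550) and `bridgeLocalCocycle_eq` (S2b) by values only.
Width seat `bsd-wall-soed-p2-w2` g11 (lead-of-record lineage of J‴ stmt-25898, taking the free step S3 of the CT lane per w3 g7's
13:02Z note); `--supports stmt-BirchSwinnertonDyer-20480`, helper.  Route-free (no `Theses` import).

THE MATHEMATICS.  `K` a number field, `Γ_K = Gal(K̄/K)`, `D` a Galois layer system (`S_E` a `Gal(E/K)`-module for every finite Galois
layer `E ⊆ K̄`, injective equivariant base changes, Galois descent `S_M^{Gal(M/E)} = S_E`; door-c5 `GalLayerData`), `lim→ S` its limit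
as a discrete `Γ_K`-module (`toDGM D.toSystem.toD`).
* §1 `exists_layerCocycle_of_absLayerCocycle` — a `2`-cocycle `b₀` of the finite quotient `Γ_K ⧸ Γ_E` with values in
  `(lim→ S)^{Γ_E}` IS a `2`-cocycle `b` of `Gal(E/K)` in `S_E`: `b₀([σ], [τ]) = [b(σ|_E, τ|_E)]_E` (transport of structure along
  `Γ_K ⧸ Γ_E = Γ_K ⧸ U_E ≅ Gal(E/K)` and `(lim→ S)^{U_E} ≅ S_E`, Tate VII §8 Prop. 8.1 in the limit — door-c6's `LayerDelta.quotEquivAbs`,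
  the inverse of its `toAbsLayerHom` on vectors, Mathlib `mapCocycles₂`, door-c5's `GalLayerData.layerCohomologyIso` read on cocycles by
  `exists_layerCohomologyIso_hom_H2π_eq`).
* §2 **`exists_galLayer_cocycle_eq_twoCocycleClass`** — DESCENT: every class `x ∈ H²_cont(Γ_K, lim→ S)` has a representative `Z`
  with `Z(σ, τ) = [b(σ|_E, τ|_E)]_E` for some layer `E` and some `2`-cocycle `b` of `Gal(E/K)` in `S_E` (uniform local constancy of a
  representing cocycle, door-c6 g10's `exists_infTwo_eq_of_discrete` = Serre I §2.2 Prop. 8 in degree `2`, then §1).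
* §3 **`brauerInvariantEquiv_twoCocycleClass_eq_localInv`** (`S = J`) — for an idèle projection `π_v : J̄ → K̄_vˣ` reading the layer
  `J_E` through door-c5's place readout (`hπ`; THE projection `IdeleReadout.ideleProjection K (inr v)` qualifies, `ideleProjection_inr_of`,
  whence `…_canonical`) and ANY continuous `2`-cocycle `c` of `Γ_{K_v}` in `K̄_vˣ` with `c(s, t) = π_v [b(s|_E, t|_E)]_E`:
  `inv_{K_v}[c] = localInv E v [b]` (door-c5's F7-dict (ii) `IdeleCohomology.localInv_eq_readout`; `c` is the pull-back of `b` along the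
  readout pair `(s ↦ s|_E, π_v^E)` on the nose).
So for the bridge cocycle `Z ∈ Z²_cont(Γ_K, J̄)` of S2: `[Z] = [Z']`, `Z'(σ, τ) = [b(σ|_E, τ|_E)]_E`, and at every finite `v` the Brauer
invariant of `[(s, t) ↦ π_v Z'(res s, res t)]` is `localInv E v [b]`; the second half of S3 (`Σ_v localInv E v [b] + Σ_w localInvInf E w [b]
= inv E [b] = classInvAll E (class of b)`, door-c5 `IdeleCohomology.inv_eq_sum_place` / `classInvAll_ideleToClass`, and the `C̄`-side
comparison) is the sequel file `…ShaTwoCochainIdeleInvariantSum`.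

Lean note (for successors working in this currency).  Rewriting with `rw` under the bundled layer types (`⇑(mapCocycles₂ …)`,
`(D.obj E).ρ`, sums in `(D.obj E).V`) or `subst`ituting `g = σ|_E` elaborates, but leaves casts whose final check exceeds the default
heartbeat budget by an order of magnitude; the proofs below therefore transport along door-c5's ready-made `layerCohomologyIso`, use
`Surjective.forall`-free statements, `simp only` for `quotEquiv⁻¹ (σ|_E) = [σ]`, and close by explicit `congrArg` terms.  Also: inside
`namespace …Theorems.ShaTwoCochain` the bare name `units` is ambiguous unless `DiscreteGaloisModule` is opened (§3 opens it).

THEOREMS ONLY (no definition, no instance, no instance attribute, no named fact, no `sorry`).  Nothing here is arithmetic beyond citing door-c5/door-c6's dictionaries —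
no case of BSD, of Poitou–Tate or of Cassels–Tate is proved; BSD is not proved by any of this.

## References
* [SerreGaloisCohomology1997] J.-P. Serre, *Galois Cohomology* (1997), I §2.2 Prop. 8 and Cor. 1 (`H^q(G, A) = lim→ H^q(G/U, A^U)`).
* [CasselsFrohlichANT1967] J. W. S. Cassels, A. Fröhlich (eds.), *Algebraic Number Theory* (1967), Ch. VII (J. Tate) §7.3 Cor. 7.4 (b),
  §8 Prop. 8.1, §9.7, §11.2.
* [MilneADT2006] J. S. Milne, *Arithmetic Duality Theorems*, 2nd ed. (2006), I Lemma 4.13 and Thm. 4.10 (a) (proof, p. 58).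
-/

noncomputable section

set_option linter.dupNamespace false
set_option autoImplicit false

namespace Summit.BirchSwinnertonDyer.BirchSwinnertonDyer.Theorems.ShaTwoCochain

open CategoryTheory groupCohomology Field NumberField IsDedekindDomain
open Literature.NumberTheory.GaloisRepresentations Literature.NumberTheory.GaloisRepresentations.IdeleClassBar
open Literature.NumberTheory.GaloisRepresentations.DGMBridge Literature.NumberTheory.GaloisRepresentations.LayerDelta
open Literature.Algebra.Homology Literature.Algebra.Homology.DiscreteRep
open scoped ContRepresentation

-- `LocallyCompactSpace Γ_K` / `Γ_{K_v}` (needed by `twoCocycleClass`) come from the tree's instance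
-- `absoluteGaloisGroup.instCompactSpace [CharZero ·]` (`K` a number field; `CharZero (v.adicCompletion K)` by `haveI` below).

variable {K : Type} [Field K] [NumberField K] (D : GalLayerData K) (E : GalLayer K) [Normal K E.1]

/-! ## §1 Transport of a layer `2`-cocycle with `Γ_E`-invariant values in `lim→ S` to a `2`-cocycle of `Gal(E/K)` in `S_E` -/

omit [NumberField K] in
/-- `(quotEquivAbs E)⁻¹ [σ] = [σ]` (the identity on representatives). [cite: SerreGaloisCohomology1997, I §2.2] -/
theorem quotEquivAbs_symm_mk (σ : absoluteGaloisGroup K) :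
    (quotEquivAbs E).symm (QuotientGroup.mk σ) = (σ : absoluteGaloisGroup K ⧸ absGaloisFixingSubgroup E.1) := by
  rw [MulEquiv.symm_apply_eq, quotEquivAbs_mk]

/-- **Every `2`-cocycle `b₀` of `Γ_K ⧸ Γ_E` with values in `(lim→ S)^{Γ_E}` is, on the nose, the inflation of a `2`-cocycle `b`
of `Gal(E/K)` in the layer `S_E`**: `b₀([σ], [τ]) = [b (σ|_E, τ|_E)]_E` for all `σ, τ ∈ Γ_K`, stated on the inflated continuous
cocycle `inflateTwoCocycle b₀` of `Γ_K`.  Transport of structure in two steps: the identity of vectors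
`(lim→ S)^{Γ_E} → (lim→ S)^{U_E}` along `Γ_K ⧸ U_E ≅ Γ_K ⧸ Γ_E` (the inverse of door-c6's `LayerDelta.toAbsLayerHom`; Mathlib
`mapCocycles₂`), then door-c5's `layerCohomologyIso` (`(lim→ S)^{U_E} ≅ S_E` along `Γ_K ⧸ U_E ≅ Gal(E/K)`, Tate VII §8 Prop. 8.1 in
the limit; cocycle formula `GalLayerData.exists_layerCohomologyIso_hom_H2π_eq`).
[cite: CasselsFrohlichANT1967, Ch. VII §8 Prop. 8.1, §9.7][cite: SerreGaloisCohomology1997, I §2.2 Proposition 8] -/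
theorem exists_layerCocycle_of_absLayerCocycle [FiniteDimensional K E.1]
    (b₀ : cocycles₂ (absGaloisLayerRep K E.1 (toDGM D.toSystem.toD))) :
    ∃ b : cocycles₂ (D.obj E), ∀ σ τ : absoluteGaloisGroup K,
      (inflateTwoCocycle K E.1 (toDGM D.toSystem.toD) b₀).1 (σ, τ) =
        LCarrier.of D.toSystem.toD (D.toSystem.of E (b (E.restrictHom σ, E.restrictHom τ))) := by
  -- step 1: the identity of vectors `(lim S)^{Γ_E} → (lim S)^{U_E}` as a morphism of `Γ_K ⧸ U_E`-modules (opaque; only its values matter)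
  obtain ⟨φ, hφ⟩ : ∃ φ : Rep.res (quotEquivAbs E).symm.toMonoidHom (absGaloisLayerRep K E.1 (toDGM D.toSystem.toD)) ⟶ D.layerRep E,
      ∀ w, ((φ.hom w).1 : D.toSystem.limit) = LCarrier.val D.toSystem.toD w.1 := by
    letI := (absGaloisLayerRep K E.1 (toDGM D.toSystem.toD)).hV2
    letI := (D.layerRep E).hV2
    let ι : (absGaloisLayerRep K E.1 (toDGM D.toSystem.toD)).V →+ (D.layerRep E).V :=
      AddMonoidHom.mk' (fun w => ⟨LCarrier.val D.toSystem.toD w.1, fun n =>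
        congrArg (LCarrier.val D.toSystem.toD) (w.2 ⟨n.1, mem_absGaloisFixingSubgroup_of_mem E n.2⟩)⟩) fun _ _ => rfl
    have hsmul : ∀ (c : ℤ) (w : (absGaloisLayerRep K E.1 (toDGM D.toSystem.toD)).V), ι (c • w) = c • ι w :=
      fun c w => map_zsmul ι c w
    refine ⟨Rep.ofHom ⟨{ toFun := ι, map_add' := fun w w' => map_add ι w w', map_smul' := hsmul }, fun g => ?_⟩,
      fun _ => rfl⟩
    induction g using QuotientGroup.induction_on with
    | H σ => exact LinearMap.ext fun w => Subtype.ext rfl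
  -- the transported `2`-cocycle of `Γ_K ⧸ U_E` in `(lim S)^{U_E}` and its values
  have hval : ∀ σ τ : absoluteGaloisGroup K,
      (((mapCocycles₂ (quotEquivAbs E).symm.toMonoidHom φ b₀) (QuotientGroup.mk σ, QuotientGroup.mk τ)).1 : D.toSystem.limit) =
        LCarrier.val D.toSystem.toD (b₀ ((σ : absoluteGaloisGroup K ⧸ absGaloisFixingSubgroup E.1),
          (τ : absoluteGaloisGroup K ⧸ absGaloisFixingSubgroup E.1))).1 := fun σ τ => by
    rw [coe_mapCocycles₂, HomDual.cochainsMap₂_apply]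
    -- `(quotEquivAbs E)⁻¹ [σ]_U = [σ]_Γ` holds by `rfl` (identity on representatives)
    exact hφ _
  -- step 2: door-c5's `layerCohomologyIso` on cocycles
  obtain ⟨b, -, hb⟩ := D.exists_layerCohomologyIso_hom_H2π_eq E (mapCocycles₂ (quotEquivAbs E).symm.toMonoidHom φ b₀)
  refine ⟨b, fun σ τ => ?_⟩
  rw [inflateTwoCocycle_apply, hb]
  -- (`simp only`, not `rw`: rewriting `quotEquiv⁻¹ (σ|_E) = [σ]` under the bundled cocycle application with `rw` produces a
  -- motive whose final check is prohibitively expensive)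
  simp only [GalLayer.quotEquiv_symm_restrictHom]
  exact (congrArg (LCarrier.of D.toSystem.toD) ((D.of_layerEquiv E _).trans (hval σ τ))).symm

/-! ## §2 Descent: every continuous `2`-cocycle of `Γ_K` in `lim→ S` is a layer cocycle up to a coboundary -/

omit [Normal K E.1] in
/-- **DESCENT (Serre CG I §2.2 Prop. 8 in degree `2`, read on door-c5's layer system).**  Every class of
`H²_cont(Γ_K, lim→_E S_E)` is represented by a continuous `2`-cocycle `Z` whose values are, ON THE NOSE, the images in `lim→ S`
of the values of a `2`-cocycle `b` of a finite Galois layer `Gal(E/K)` in `S_E`: `Z(σ, τ) = [b(σ|_E, τ|_E)]_E`.  (Uniform local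
constancy of a representing cocycle gives the layer, `exists_infTwo_eq_of_discrete`; the `Γ_E`-invariant values descend to `S_E` by
Galois descent in the limit, `exists_layerCocycle_of_absLayerCocycle`.)  For `S = J` (idèles) resp. `C` (idèle classes) this is the
first half of step S3 of the Ш²-cochain bridge (`Cruxes/WildKolyvaginUpperAtThree/SHA2-BRIDGE-w3g7.md` §1 (vi)).
[cite: SerreGaloisCohomology1997, I §2.2 Prop. 8 and Cor. 1][cite: CasselsFrohlichANT1967, Ch. VII §8 Prop. 8.1, §9.7, §11.1] -/
theorem exists_galLayer_cocycle_eq_twoCocycleClass (x : galoisCohomology (toDGM D.toSystem.toD) 2) :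
    ∃ (E : GalLayer K) (b : cocycles₂ (D.obj E)) (Z : contTwoCocycles (toDGM D.toSystem.toD).toTopRep),
      twoCocycleClass (toDGM D.toSystem.toD).toTopRep Z = x ∧
        ∀ σ τ : absoluteGaloisGroup K,
          Z.1 (σ, τ) = LCarrier.of D.toSystem.toD (D.toSystem.of E (b (E.restrictHom σ, E.restrictHom τ))) := by
  obtain ⟨E₀, hfd, hgal, y, hy⟩ := exists_infTwo_eq_of_discrete K (toDGM D.toSystem.toD) x
  let E : GalLayer K := ⟨E₀, hfd, hgal⟩
  haveI : Normal K E.1 := normal_layer E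
  haveI : FiniteDimensional K E.1 := hfd
  induction y using H2_induction_on with
  | h b₀ =>
    obtain ⟨b, hb⟩ := exists_layerCocycle_of_absLayerCocycle D E b₀
    exact ⟨E, b, inflateTwoCocycle K E.1 (toDGM D.toSystem.toD) b₀, (infTwo_H2π K E.1 _ b₀).symm.trans hy, hb⟩

/-! ## §3 The local dictionary at a finite place: the class of `(s, t) ↦ π_v [b(s|_E, t|_E)]_E` has Brauer invariant `inv_{w_v}[b]` -/

section Idele

open HomDual IdeleReadout IdeleCohomology DiscreteGaloisModule
open Literature.NumberTheory.Automorphic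
open Literature.AnabelianGeometry.AbsoluteAnabelian.Prop121vii (brauerInvariantEquiv)

omit [Normal K E.1] in
/-- **F7-dict (ii) for the descended cocycle at a finite place `v`.**  For a layer `E`, a `2`-cocycle `b` of `Gal(E/K)` in `J_E`, an
idèle projection `π_v : J̄ → K̄_vˣ` reading the layer `J_E ⊆ J̄` through door-c5's place readout (`hπ`; for THE projection
`IdeleReadout.ideleProjection K (inr v)` this is `ideleProjection_inr_of`), and ANY continuous `2`-cocycle `c` of `Γ_{K_v}` in
`K̄_vˣ` with the values `c(s, t) = π_v [b(s|_E, t|_E)]_E`: the local invariant of `[c] ∈ H²(K_v, K̄_vˣ) = Br(K_v)` is the idèle local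
invariant `inv_{w_v}[b]` of door-c5 (`IdeleCohomology.localInv E v`).  (`c` is the pull-back of `b` along door-c5's readout pair
`(s ↦ s|_E, π_v^E)` on the nose; then `localInv_eq_readout`.)
[cite: CasselsFrohlichANT1967, Ch. VII §7.3 Cor. 7.4 (b), §11.2][cite: MilneADT2006, I Lemma 4.13 (proof)] -/
theorem brauerInvariantEquiv_twoCocycleClass_eq_localInv (v : HeightOneSpectrum (𝓞 K)) (π : IdeleProjection K (Sum.inr v))
    (hπ : ∀ x : (ideleData K).V E, π.toAddMonoidHom ((ideleData K).toSystem.of E x) =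
      (haveI := E.numberField; haveI := E.isGalois; idelePlaceReadout v (layerEmb E) x))
    (b : cocycles₂ ((ideleData K).obj E))
    (c : haveI := charZero_adicCompletion v; contTwoCocycles (units (v.adicCompletion K)).toTopRep)
    (hc : ∀ s t : absoluteGaloisGroup (v.adicCompletion K),
      c.1 (s, t) = π.toAddMonoidHom ((ideleData K).toSystem.of E
        (b (E.restrictHom (absGaloisRestrict K (v.adicCompletion K) s), E.restrictHom (absGaloisRestrict K (v.adicCompletion K) t))))) :
    (haveI := charZero_adicCompletion v;
      brauerInvariantEquiv (v.adicCompletion K) (twoCocycleClass (units (v.adicCompletion K)).toTopRep c)) =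
      (haveI := E.numberField; haveI := E.isGalois; localInv E.1 v (H2π (IdeleClassGroup.ideleRep K E.1) b)) := by
  haveI := E.numberField
  haveI := E.isGalois
  haveI : CharZero (v.adicCompletion K) := charZero_adicCompletion v
  have hcb : c = (readoutPair v (layerEmb E)).pull b := by
    refine Subtype.ext (ContinuousMap.ext fun st => ?_)
    obtain ⟨s, t⟩ := st
    rw [hc, CompatiblePair.pull_apply, readoutPair_f, readoutPair_f, readoutPair_φ, galRestrict_layerEmb, galRestrict_layerEmb]
    exact hπ _
  rw [hcb]
  exact (localInv_eq_readout v (layerEmb E) b).symm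

omit [Normal K E.1] in
/-- **The same for THE idèle projection** `IdeleReadout.ideleProjection K (inr v)` (its layer compatibility is
`ideleProjection_inr_of`). [cite: CasselsFrohlichANT1967, Ch. VII §7.3 Cor. 7.4 (b), §11.2] -/
theorem brauerInvariantEquiv_twoCocycleClass_eq_localInv_canonical (v : HeightOneSpectrum (𝓞 K))
    (b : cocycles₂ ((ideleData K).obj E))
    (c : haveI := charZero_adicCompletion v; contTwoCocycles (units (v.adicCompletion K)).toTopRep)
    (hc : ∀ s t : absoluteGaloisGroup (v.adicCompletion K),
      c.1 (s, t) = (ideleProjection K (Sum.inr v)).toAddMonoidHom ((ideleData K).toSystem.of E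
        (b (E.restrictHom (absGaloisRestrict K (v.adicCompletion K) s), E.restrictHom (absGaloisRestrict K (v.adicCompletion K) t))))) :
    (haveI := charZero_adicCompletion v;
      brauerInvariantEquiv (v.adicCompletion K) (twoCocycleClass (units (v.adicCompletion K)).toTopRep c)) =
      (haveI := E.numberField; haveI := E.isGalois; localInv E.1 v (H2π (IdeleClassGroup.ideleRep K E.1) b)) :=
  brauerInvariantEquiv_twoCocycleClass_eq_localInv E v (ideleProjection K (Sum.inr v)) (ideleProjection_inr_of v E) b c hc

end Idele

end Summit.BirchSwinnertonDyer.BirchSwinnertonDyer.Theorems.ShaTwoCochain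

end
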